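import Summits.CriticalPhenomena.PercolationContinuityZ3.Theorems.PercNearOneGluingNoHeavyLowerTailCILCutObserverTools
import HarnessLib

/-!
# `NoHeavyLowerTail` (stmt-CriticalPhenomena-4575) — the cumulative isolation lemma for a CUT OBSERVER
# (observer at an articulation point: its neighbours are relays lying in different components of `G − o`)

Support file (prover `prim-gen-induct`, strategy "induction on the blob quotient"; `--supports
stmt-CriticalPhenomena-4575`).  No definitions, no named facts, no sorries.

Notation: `μ = prodBernoulli w` on `Fin n`, relays `A`, observer `o ∉ A`, `N = |{x ∈ A : o ↔ x}|`,
`π(a) = {x ∈ A : a ↔ x}`, level `j`.  The lead's typed engine for the crux is the CUMULATIVE ISOLATION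
LEMMA `CIL_j : ∃ a ∈ A, μ{1 ≤ N ≤ j} ≤ μ{|π(a)| ≤ j}` (registered stub `stub_cumulativeIsolation`,
reduction `Theorems.noHeavyLowerTail_of_stub_cumulativeIsolation`; landed for `|A| ≤ 4` and for blob
structures with at most four blobs).

## What is proved here

`cumulativeIsolation_cutObserver` — **CIL at every level, for every number of relays, whenever the
observer is a cut point whose neighbours are relays**: the vertices other than `o` are partitioned into
branches `V₀, …, V_{d−1}`, the only positive-weight edges at `o` go to one PORT relay `p l ∈ V l ∩ A` per
branch, and there are no positive-weight edges between different branches (inside a branch the weighted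
graph is arbitrary: further relays, Steiner vertices, any weights).  Then for every `j` some relay `a`
(namely the port whose branch cluster is most likely to be light) has `μ{1 ≤ N ≤ j} ≤ μ{|π(a)| ≤ j}`.

This is the ROOT STEP of the blob-quotient recursion: with `X_l = {edge o–p_l open}` (probability
`c_l = w(o,p_l)`) and `M_l = |C_{V_l}(p_l) ∩ A|` (relay mass of the port's cluster inside its branch),
the families `(X_l, M_l)` are independent across `l` and `N = Σ_l 𝟙[X_l]·M_l`.  For the port `p_i` with
`s_i = μ{M_i ≤ j}` maximal:  on `X_i`, `π(p_i) = π(o)`;  off `X_i`, `π(p_i)` is the branch cluster, and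
`μ{1 ≤ N ≤ j, X_iᶜ} ≤ μ(X_iᶜ)·(∏_{l≠i}(1 − c_l + c_l s_l) − ∏_{l≠i}(1 − c_l)) ≤ μ(X_iᶜ)·s_i·(1 − ∏_{l≠i}(1−c_l))
≤ μ(X_iᶜ)·s_i = μ{X_iᶜ, M_i ≤ j}` by the telescoping inequality `CutObserver.prod_sub_prod_le`.
The class contains every BLOB TREE whose root blob is `{o}` with single attachment edges (chains,
stars of blobs, stars of arbitrary weighted graphs hung from a relay), for any number of blobs — the
tight families of the crux's census (two-blob, blob chains) are of this kind up to gluing `o` into a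
relay (`CILBlobs.cil_of_glued`).  What it does NOT cover is exactly the crux's difficulty: branches that
talk to each other away from `o` (a common relay structure), where `π(p_i)` off `X_i` is no longer the
branch cluster.

Numerics (exact partition DP, this seat, `n ≤ 8`, random branch structures): 0 violations, as proved.
The complementary census result of this seat (crux notes `BLOBQUOTIENT.md`): the literal blob-quotient
monotonicity "some pair contraction does not decrease `μ{1≤N≤j} − max_a μ{|π(a)|≤j}`" is FALSE already at
`|A| = 5` (generic weights), and every max-type bound is rigid under contraction on the star, so the
induction on `|A|` cannot run on the pair `(bad, bound)` alone; the present theorem is what the recursion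
does give unconditionally.
-/

noncomputable section

namespace Summit.CriticalPhenomena.PercolationContinuityZ3.Theorems

open MeasureTheory Set Literature.Probability.LatticeModels Literature.Probability.Percolation
open scoped Classical BigOperators

variable {n : ℕ}

open CutObserver in
/-- **The cumulative isolation lemma for a cut observer, every level, every number of relays.**
Let the vertices other than the observer `o ∉ A` be partitioned into branches `V l` (`l < d`), each
with a port relay `p l ∈ V l ∩ A`; suppose the only positive-weight edges at `o` are the port edges
`o–p l` and there are no positive-weight edges between different branches (inside a branch: anything).
Then for every level `j` some relay `a ∈ A` satisfies `μ{1 ≤ N ≤ j} ≤ μ{|π(a)| ≤ j}` — the conclusion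
of the registered stub `stub_cumulativeIsolation` (crux `NoHeavyLowerTail`, stmt-CriticalPhenomena-4575)
on this class.  Witness: the port `p i` maximising `μ{M_i ≤ j}`, `M_l` = relay mass of the port's
cluster inside its branch.  Proof: on `{o–p i open}`, `π(p i) = π(o)`; off it, `π(p i)` is the branch
cluster, `{1 ≤ N ≤ j}` forces "some other port edge open and every open port leads to a light branch",
whose probability factorises over the branches (`prodBernoulli_real_inter_biInter_of_determinedBy`)
and is at most `μ{M_i ≤ j}` by the telescoping inequality `CutObserver.prod_sub_prod_le`. [folklore] -/
theorem cumulativeIsolation_cutObserver (w : Sym2 (Fin n) → unitInterval) (A : Finset (Fin n))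
    (o : Fin n) (j : ℕ) {d : ℕ} (V : Fin d → Finset (Fin n)) (p : Fin d → Fin n)
    (hA : A.Nonempty) (hoA : o ∉ A)
    (hpV : ∀ l, p l ∈ V l) (hpA : ∀ l, p l ∈ A) (hoV : ∀ l, o ∉ V l)
    (hdisj : ∀ l l', l ≠ l' → Disjoint (V l) (V l'))
    (hcover : ∀ v, v ≠ o → ∃ l, v ∈ V l)
    (hobs : ∀ v, v ≠ o → (∀ l, v ≠ p l) → w s(o, v) = 0)
    (hsep : ∀ l l', l ≠ l' → ∀ u ∈ V l, ∀ v ∈ V l', w s(u, v) = 0) :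
    ∃ a ∈ A,
      (prodBernoulli w).real {ω : BondConfig (Fin n) |
          1 ≤ (A.filter fun x => ω ∈ openConn o x).card ∧
            (A.filter fun x => ω ∈ openConn o x).card ≤ j} ≤
        (prodBernoulli w).real {ω : BondConfig (Fin n) |
          (A.filter fun x => ω ∈ openConn a x).card ≤ j} := by
  haveI : IsProbabilityMeasure (prodBernoulli w) := inferInstance
  -- there is at least one branch
  obtain ⟨a₀, ha₀⟩ := hA
  obtain ⟨l₀, -⟩ := hcover a₀ fun h => hoA (h ▸ ha₀)
  -- branch masses and the witness port
  set M : Fin d → BondConfig (Fin n) → ℕ := fun l ω =>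
    (A.filter fun x => (openGraph (ω ∩ ↑((V l).sym2))).Reachable (p l) x).card with hM
  set sl : Fin d → ℝ := fun l => (prodBernoulli w).real {ω : BondConfig (Fin n) | M l ω ≤ j} with hsl
  obtain ⟨i, -, hi⟩ := Finset.exists_max_image Finset.univ sl ⟨l₀, Finset.mem_univ _⟩
  refine ⟨p i, hpA i, ?_⟩
  set c : Fin d → ℝ := fun l => (w s(o, p l) : ℝ) with hc
  set bad := {ω : BondConfig (Fin n) | 1 ≤ (A.filter fun x => ω ∈ openConn o x).card ∧
    (A.filter fun x => ω ∈ openConn o x).card ≤ j} with hbad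
  set Tgt := {ω : BondConfig (Fin n) | (A.filter fun x => ω ∈ openConn (p i) x).card ≤ j} with hTgt
  set Xi := {ω : BondConfig (Fin n) | s(o, p i) ∈ ω} with hXi
  set Xc : Fin d → Set (BondConfig (Fin n)) := fun l => {ω | s(o, p l) ∉ ω} with hXc
  set NF : Fin d → Set (BondConfig (Fin n)) := fun l => {ω | s(o, p l) ∈ ω → M l ω ≤ j} with hNF
  set G := {ω : BondConfig (Fin n) | ∀ e ∈ ω, w e ≠ 0} with hG
  set T := Finset.univ.erase i with hT
  -- (2a) on the port edge: π(p i) = π(o)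
  have h2a : (prodBernoulli w).real (bad ∩ Xi) ≤ (prodBernoulli w).real (Tgt ∩ Xi) := by
    refine measureReal_mono (fun ω hω => ?_) (measure_ne_top _ _)
    obtain ⟨⟨_, hj⟩, hX⟩ := hω
    refine ⟨?_, hX⟩
    have hoi : (openGraph ω).Reachable o (p i) := by
      refine SimpleGraph.Adj.reachable ?_
      rw [openGraph, SimpleGraph.fromEdgeSet_adj]
      exact ⟨hX, fun h => hoV i (h ▸ hpV i)⟩
    show (A.filter fun x => ω ∈ openConn (p i) x).card ≤ j
    have heq : (A.filter fun x => ω ∈ openConn (p i) x) = (A.filter fun x => ω ∈ openConn o x) :=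
      Finset.filter_congr fun x _ => ⟨fun h => hoi.trans h, fun h => hoi.symm.trans h⟩
    rw [heq]
    exact hj
  -- (2b) off the port edge
  have h2b : (prodBernoulli w).real (bad \ Xi) ≤ (prodBernoulli w).real (Tgt \ Xi) := by
    have hdiff1 : bad \ Xi = bad ∩ Xc i := Set.ext fun ω => Iff.rfl
    have hdiff2 : Tgt \ Xi = Tgt ∩ Xc i := Set.ext fun ω => Iff.rfl
    rw [hdiff1, hdiff2]
    -- pointwise: the minority event off the port lies in (⋂ NF) \ (⋂ Xc) over the other branches
    have hQP : (Xc i ∩ ⋂ l ∈ T, Xc l) ⊆ Xc i ∩ ⋂ l ∈ T, NF l := by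
      refine inter_subset_inter_right _ (biInter_mono (fun l hl => hl) fun l _ ω hω => ?_)
      exact fun h => absurd h hω
    have hsub : (bad ∩ Xc i) ∩ G ⊆ (Xc i ∩ ⋂ l ∈ T, NF l) \ (Xc i ∩ ⋂ l ∈ T, Xc l) := by
      rintro ω ⟨⟨⟨h1, hj⟩, hXci⟩, hωG⟩
      obtain ⟨hall, hsome⟩ := bad_offPort_subset w A o V p hoA hpV hoV hobs i j ω hωG hXci h1 hj
      refine ⟨⟨hXci, mem_biInter fun l hl => hall l hl⟩, fun h => hsome fun l hl => ?_⟩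
      exact (mem_iInter₂.1 h.2) l hl
    -- supports
    have hSdisj : (↑T : Set (Fin d)).PairwiseDisjoint fun l => insert s(o, p l) (V l).sym2 :=
      fun k _ k' _ hkk' => supports_disjoint o V p hpV hoV hdisj hkk'
    have hXci_det : DeterminedBy (Xc i)
        (⋃ l ∈ T, (↑(insert s(o, p l) (V l).sym2) : Set (Sym2 (Fin n))))ᶜ := by
      refine (determinedBy_closed (s(o, p i))).mono ?_
      intro e he
      rw [Finset.coe_singleton, mem_singleton_iff] at he
      subst he
      simp only [mem_compl_iff, mem_iUnion, Finset.mem_coe, not_exists]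
      intro l hl
      exact portEdge_not_mem o V p hpV hoV hdisj (Finset.mem_erase.1 hl).1.symm
    have hprodNF : (prodBernoulli w).real (Xc i ∩ ⋂ l ∈ T, NF l) =
        (prodBernoulli w).real (Xc i) * ∏ l ∈ T, (prodBernoulli w).real (NF l) :=
      prodBernoulli_real_inter_biInter_of_determinedBy w T _ hSdisj
        (fun l _ => determinedBy_noHeavy A (V l) (p l) j s(o, p l))
        (fun l _ => MeasurableSet.of_discrete) hXci_det MeasurableSet.of_discrete
    have hprodXc : (prodBernoulli w).real (Xc i ∩ ⋂ l ∈ T, Xc l) =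
        (prodBernoulli w).real (Xc i) * ∏ l ∈ T, (prodBernoulli w).real (Xc l) :=
      prodBernoulli_real_inter_biInter_of_determinedBy w T _ hSdisj
        (fun l _ => (determinedBy_closed (s(o, p l))).mono (by
          rw [Finset.coe_singleton, singleton_subset_iff, Finset.mem_coe]
          exact Finset.mem_insert_self _ _))
        (fun l _ => MeasurableSet.of_discrete) hXci_det MeasurableSet.of_discrete
    have hNFval : ∏ l ∈ T, (prodBernoulli w).real (NF l) = ∏ l ∈ T, (1 - c l + c l * sl l) :=
      Finset.prod_congr rfl fun l _ =>
        measureReal_noHeavy w A (V l) (p l) j s(o, p l) (portEdge_not_mem_sym2 o V p hoV l)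
    have hXcval : ∏ l ∈ T, (prodBernoulli w).real (Xc l) = ∏ l ∈ T, (1 - c l) :=
      Finset.prod_congr rfl fun l _ => measureReal_closed w s(o, p l)
    have hc0 : ∀ l ∈ T, 0 ≤ c l := fun l _ => (w s(o, p l)).2.1
    have hc1 : ∀ l ∈ T, c l ≤ 1 := fun l _ => (w s(o, p l)).2.2
    have hs0 : ∀ l ∈ T, 0 ≤ sl l := fun l _ => measureReal_nonneg
    have hsi : ∀ l ∈ T, sl l ≤ sl i := fun l _ => hi l (Finset.mem_univ _)
    have hsi1 : sl i ≤ 1 := measureReal_le_one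
    have htel := prod_sub_prod_le T c sl (sl i) hc0 hc1 hs0 hsi hsi1
    have hP0 : 0 ≤ ∏ l ∈ T, (1 - c l) := Finset.prod_nonneg fun l hl => by linarith [hc1 l hl]
    have hind : (prodBernoulli w).real (Xc i ∩ {ω : BondConfig (Fin n) | M i ω ≤ j}) =
        (prodBernoulli w).real (Xc i) * sl i :=
      prodBernoulli_real_inter_of_determinedBy_disjoint w
        (Finset.disjoint_singleton_left.2 (portEdge_not_mem_sym2 o V p hoV i))
        (determinedBy_closed (s(o, p i))) (determinedBy_branchMass A (V i) (p i) j)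
        MeasurableSet.of_discrete MeasurableSet.of_discrete
    have hlast : Xc i ∩ {ω : BondConfig (Fin n) | M i ω ≤ j} ∩ G ⊆ Tgt ∩ Xc i := by
      rintro ω ⟨⟨hXci, hMi⟩, hωG⟩
      refine ⟨?_, hXci⟩
      show (A.filter fun x => ω ∈ openConn (p i) x).card ≤ j
      rw [piCard_eq_branchMass w A o V p hpV hoV hdisj hcover hobs hsep i ω hωG hXci]
      exact hMi
    calc (prodBernoulli w).real (bad ∩ Xc i)
        = (prodBernoulli w).real ((bad ∩ Xc i) ∩ G) := (measureReal_inter_support w _).symm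
      _ ≤ (prodBernoulli w).real ((Xc i ∩ ⋂ l ∈ T, NF l) \ (Xc i ∩ ⋂ l ∈ T, Xc l)) :=
          measureReal_mono hsub (measure_ne_top _ _)
      _ = (prodBernoulli w).real (Xc i ∩ ⋂ l ∈ T, NF l) -
            (prodBernoulli w).real (Xc i ∩ ⋂ l ∈ T, Xc l) :=
          measureReal_sdiff hQP MeasurableSet.of_discrete
      _ = (prodBernoulli w).real (Xc i) *
            (∏ l ∈ T, (1 - c l + c l * sl l) - ∏ l ∈ T, (1 - c l)) := by
          rw [hprodNF, hprodXc, hNFval, hXcval, mul_sub]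
      _ ≤ (prodBernoulli w).real (Xc i) * (sl i * (1 - ∏ l ∈ T, (1 - c l))) :=
          mul_le_mul_of_nonneg_left htel measureReal_nonneg
      _ ≤ (prodBernoulli w).real (Xc i) * sl i := by
          refine mul_le_mul_of_nonneg_left ?_ measureReal_nonneg
          have : 0 ≤ sl i := measureReal_nonneg
          nlinarith
      _ = (prodBernoulli w).real (Xc i ∩ {ω : BondConfig (Fin n) | M i ω ≤ j}) := hind.symm
      _ = (prodBernoulli w).real ((Xc i ∩ {ω : BondConfig (Fin n) | M i ω ≤ j}) ∩ G) :=
          (measureReal_inter_support w _).symm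
      _ ≤ (prodBernoulli w).real (Tgt ∩ Xc i) := measureReal_mono hlast (measure_ne_top _ _)
  -- assemble
  have hb := measureReal_inter_add_sdiff (μ := prodBernoulli w) (s := bad)
    (MeasurableSet.of_discrete (s := Xi)) (measure_ne_top _ _)
  have ht := measureReal_inter_add_sdiff (μ := prodBernoulli w) (s := Tgt)
    (MeasurableSet.of_discrete (s := Xi)) (measure_ne_top _ _)
  linarith

end Summit.CriticalPhenomena.PercolationContinuityZ3.Theorems

end
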